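import Mathlib.MeasureTheory.Integral.MeanInequalities
import Mathlib.MeasureTheory.Measure.Count
import Mathlib.MeasureTheory.Integral.Lebesgue.Countable
import Mathlib.Analysis.SpecificLimits.Basic
import HarnessLib

/-!
# Dyadic summation lemmas over `ℤ` in `ℝ≥0∞`

Analysis/FunctionSpaces support file (serves the discharge of
`Literature.Analysis.FluidPDE.cheskidov_shvydkoy`, ns.S31). The paraproduct estimates of
Cheskidov–Shvydkoy's Lemma 3.2 (arXiv:0708.3067, pp. 5–6: the bounds on `I`, `II`, `III` by
"Young and Jensen's inequalities") are sums over pairs of dyadic indices with geometric off-diagonal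
decay; summing them needs two elementary facts about nonnegative sequences indexed by `ℤ`, proved
here with `tsum` in `ℝ≥0∞` (no summability bookkeeping):

* `tsum_mul_shift_le`: shifted Cauchy–Schwarz `∑_j α_j β_{j+m} ≤ (∑ α²)^{1/2} (∑ β²)^{1/2}`;
* `tsum_tsum_geometric_mul_shift_le`: Schur's bound for the geometric kernel,
  `∑_j ∑_{m ≥ 0} 2^{-m} α_j β_{j+m} ≤ 2 (∑ α²)^{1/2} (∑ β²)^{1/2}` (and the version with `β_{j-m}`).

## References

* A. Cheskidov, R. Shvydkoy, Arch. Ration. Mech. Anal. 195 (2010), proof of Lemma 3.2, pp. 5–6.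
  [CheskidovShvydkoy2010]
-/

noncomputable section

open MeasureTheory Filter Topology
open scoped ENNReal NNReal

namespace Literature.Analysis.FunctionSpaces

/-- **Shifted Cauchy–Schwarz over `ℤ`**: `∑_j α_j β_{j+m} ≤ (∑_j α_j²)^{1/2} (∑_j β_j²)^{1/2}`
(Hölder for the counting measure and translation invariance of `∑_j β_{j+m}²`). [folklore] -/
theorem tsum_mul_shift_le (α β : ℤ → ℝ≥0∞) (m : ℤ) :
    ∑' j, α j * β (j + m) ≤ (∑' j, α j ^ 2) ^ (1 / 2 : ℝ) * (∑' j, β j ^ 2) ^ (1 / 2 : ℝ) := by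
  have h := ENNReal.lintegral_mul_le_Lp_mul_Lq (Measure.count : Measure ℤ) Real.HolderConjugate.two_two
    (f := α) (g := fun j => β (j + m)) (Measurable.of_discrete.aemeasurable) (Measurable.of_discrete.aemeasurable)
  simp only [lintegral_count, Pi.mul_apply, ENNReal.rpow_two] at h
  have hshift : ∑' j, β (j + m) ^ 2 = ∑' j, β j ^ 2 :=
    (Equiv.addRight m).tsum_eq (fun j => β j ^ 2)
  simpa [hshift] using h

/-- Shifted Cauchy–Schwarz with a backward shift: `∑_j α_j β_{j-m} ≤ (∑ α²)^{1/2} (∑ β²)^{1/2}`. [folklore] -/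
theorem tsum_mul_shift_sub_le (α β : ℤ → ℝ≥0∞) (m : ℤ) :
    ∑' j, α j * β (j - m) ≤ (∑' j, α j ^ 2) ^ (1 / 2 : ℝ) * (∑' j, β j ^ 2) ^ (1 / 2 : ℝ) := by
  simpa [sub_eq_add_neg] using tsum_mul_shift_le α β (-m)

/-- **Schur's bound for the geometric kernel, forward shifts**:
`∑_j ∑_{m ≥ 0} 2^{-m} α_j β_{j+m} ≤ 2 (∑ α²)^{1/2} (∑ β²)^{1/2}`. [folklore] -/
theorem tsum_tsum_geometric_mul_shift_le (α β : ℤ → ℝ≥0∞) :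
    ∑' j, ∑' m : ℕ, (2⁻¹ : ℝ≥0∞) ^ m * (α j * β (j + m)) ≤
      2 * ((∑' j, α j ^ 2) ^ (1 / 2 : ℝ) * (∑' j, β j ^ 2) ^ (1 / 2 : ℝ)) := by
  rw [ENNReal.tsum_comm]
  calc ∑' m : ℕ, ∑' j, (2⁻¹ : ℝ≥0∞) ^ m * (α j * β (j + m))
      = ∑' m : ℕ, (2⁻¹ : ℝ≥0∞) ^ m * ∑' j, α j * β (j + m) := by
        refine tsum_congr fun m => ?_
        rw [ENNReal.tsum_mul_left]
    _ ≤ ∑' m : ℕ, (2⁻¹ : ℝ≥0∞) ^ m * ((∑' j, α j ^ 2) ^ (1 / 2 : ℝ) * (∑' j, β j ^ 2) ^ (1 / 2 : ℝ)) := by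
        refine ENNReal.tsum_le_tsum fun m => mul_le_mul_right ?_ _
        exact tsum_mul_shift_le α β m
    _ = 2 * ((∑' j, α j ^ 2) ^ (1 / 2 : ℝ) * (∑' j, β j ^ 2) ^ (1 / 2 : ℝ)) := by
        rw [ENNReal.tsum_mul_right, ENNReal.tsum_geometric_two]

/-- **Schur's bound for the geometric kernel, backward shifts**:
`∑_j ∑_{m ≥ 0} 2^{-m} α_j β_{j-m} ≤ 2 (∑ α²)^{1/2} (∑ β²)^{1/2}`. [folklore] -/
theorem tsum_tsum_geometric_mul_shift_sub_le (α β : ℤ → ℝ≥0∞) :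
    ∑' j, ∑' m : ℕ, (2⁻¹ : ℝ≥0∞) ^ m * (α j * β (j - m)) ≤
      2 * ((∑' j, α j ^ 2) ^ (1 / 2 : ℝ) * (∑' j, β j ^ 2) ^ (1 / 2 : ℝ)) := by
  rw [ENNReal.tsum_comm]
  calc ∑' m : ℕ, ∑' j, (2⁻¹ : ℝ≥0∞) ^ m * (α j * β (j - m))
      = ∑' m : ℕ, (2⁻¹ : ℝ≥0∞) ^ m * ∑' j, α j * β (j - m) := by
        refine tsum_congr fun m => ?_
        rw [ENNReal.tsum_mul_left]
    _ ≤ ∑' m : ℕ, (2⁻¹ : ℝ≥0∞) ^ m * ((∑' j, α j ^ 2) ^ (1 / 2 : ℝ) * (∑' j, β j ^ 2) ^ (1 / 2 : ℝ)) := by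
        refine ENNReal.tsum_le_tsum fun m => mul_le_mul_right ?_ _
        exact tsum_mul_shift_sub_le α β m
    _ = 2 * ((∑' j, α j ^ 2) ^ (1 / 2 : ℝ) * (∑' j, β j ^ 2) ^ (1 / 2 : ℝ)) := by
        rw [ENNReal.tsum_mul_right, ENNReal.tsum_geometric_two]

/-- The unshifted Cauchy–Schwarz: `∑_j α_j β_j ≤ (∑ α²)^{1/2} (∑ β²)^{1/2}`. [folklore] -/
theorem tsum_mul_le_sqrt_mul_sqrt (α β : ℤ → ℝ≥0∞) :
    ∑' j, α j * β j ≤ (∑' j, α j ^ 2) ^ (1 / 2 : ℝ) * (∑' j, β j ^ 2) ^ (1 / 2 : ℝ) := by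
  simpa using tsum_mul_shift_le α β 0

/-- Young's inequality for the square-root product: `A^{1/2} B^{1/2} ≤ (ε A + ε⁻¹ B)/2 ≤ ε A + ε⁻¹ B`
for `ε ≠ 0, ∞`, in the crude form `2 A^{1/2} B^{1/2} ≤ ε A + ε⁻¹ B`. [folklore] -/
theorem two_mul_sqrt_mul_sqrt_le (A B : ℝ≥0∞) {ε : ℝ≥0∞} (hε : ε ≠ 0) (hε' : ε ≠ ∞) :
    2 * (A ^ (1 / 2 : ℝ) * B ^ (1 / 2 : ℝ)) ≤ ε * A + ε⁻¹ * B := by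
  -- `2xy ≤ x² + y²` with `x = (εA)^{1/2}`, `y = (ε⁻¹B)^{1/2}`
  have key : ∀ x y : ℝ≥0∞, 2 * (x * y) ≤ x ^ 2 + y ^ 2 := by
    intro x y
    rcases eq_or_ne x ∞ with rfl | hx
    · simp
    rcases eq_or_ne y ∞ with rfl | hy
    · simp
    lift x to ℝ≥0 using hx
    lift y to ℝ≥0 using hy
    have : (2 : ℝ≥0) * (x * y) ≤ x ^ 2 + y ^ 2 := by
      rw [← NNReal.coe_le_coe]; push_cast; nlinarith [sq_nonneg ((x : ℝ) - y)]
    exact_mod_cast this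
  have hx : ((ε * A) ^ (1 / 2 : ℝ)) ^ 2 = ε * A := by
    rw [← ENNReal.rpow_natCast, ← ENNReal.rpow_mul]; norm_num
  have hy : ((ε⁻¹ * B) ^ (1 / 2 : ℝ)) ^ 2 = ε⁻¹ * B := by
    rw [← ENNReal.rpow_natCast, ← ENNReal.rpow_mul]; norm_num
  have hprod : (ε * A) ^ (1 / 2 : ℝ) * (ε⁻¹ * B) ^ (1 / 2 : ℝ) = A ^ (1 / 2 : ℝ) * B ^ (1 / 2 : ℝ) := by
    rw [ENNReal.mul_rpow_of_nonneg _ _ (by norm_num), ENNReal.mul_rpow_of_nonneg _ _ (by norm_num)]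
    calc ε ^ (1 / 2 : ℝ) * A ^ (1 / 2 : ℝ) * (ε⁻¹ ^ (1 / 2 : ℝ) * B ^ (1 / 2 : ℝ))
        = (ε ^ (1 / 2 : ℝ) * ε⁻¹ ^ (1 / 2 : ℝ)) * (A ^ (1 / 2 : ℝ) * B ^ (1 / 2 : ℝ)) := by ring
      _ = A ^ (1 / 2 : ℝ) * B ^ (1 / 2 : ℝ) := by
          rw [← ENNReal.mul_rpow_of_nonneg _ _ (by norm_num), ENNReal.mul_inv_cancel hε hε',
            ENNReal.one_rpow, one_mul]
  have h := key ((ε * A) ^ (1 / 2 : ℝ)) ((ε⁻¹ * B) ^ (1 / 2 : ℝ))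
  rwa [hprod, hx, hy] at h

end Literature.Analysis.FunctionSpaces

end
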